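import Mathlib
import HarnessLib
import Literature.AlgebraicGeometry.Ramification.InertiaStalkNormalSylow
import Literature.AlgebraicGeometry.Resolution.ResolutionOfSingularities
import Literature.AlgebraicGeometry.Resolution.AlterationsSemiStableCodimTwo
import Literature.AlgebraicGeometry.Resolution.CompleteLocalDomainNormalization
import Literature.AlgebraicGeometry.Resolution.RegularCentreRsopPart
import Summits.ResolutionOfSingularities.ResolutionOfSingularities.Theorems.WildQuotientsWildQuotientResolutionPhaseZeroDimOne

/-!
# Non-p-closed inertia lives in codimension `≥ 2` — any dimension (crux `WildQuotients.WildQuotientResolution`, Phase 0)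

Crux stmt-ResolutionOfSingularities-15640 (`WildQuotientResolution`), line `Sketch` (card
`p-closure-sylow-separation`), registered stub `stub_phaseZeroHighDim`. The dimension-free form of
the first step of `NpcCentre.stub_npcCentre` (`Theorems/…StubNpcCentre.lean`, which concludes, on a
SURFACE, that the non-p-closed inertia locus NPC is a finite set of closed points): at a point
`z` of a regular integral `G`-scheme (faithful action over the affine `q`, over a field of
characteristic `p`) whose inertia group is NOT p-closed, the local ring has dimension `≥ 2` — the
generic point has trivial inertia (`PhaseZeroDimOne.inertiaSubgroup_genericPoint_eq_bot`) and a
codimension-one point has a discrete valuation ring, whose inertia is p-closed (Serre IV §2,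
`hasNormalSylow_inertiaSubgroup_of_isIntegral`). On a threefold this says NPC consists of curves
and closed points — the input of the move order (point moves `PointMove.pointMove` to regularise
the curves, then curve moves `CurveStep.curveMove`).

[OURS · crux stmt-ResolutionOfSingularities-15640 · helper toward `stub_phaseZeroHighDim`; counted
0; AI-level work, weaker than expert review.]
-/

-- single-problem summit: the doubled namespace component `ResolutionOfSingularities` is forced
set_option linter.dupNamespace false

namespace Summit.ResolutionOfSingularities.ResolutionOfSingularities.Theorems.WildQuotientResolution.NpcCodim

open CategoryTheory AlgebraicGeometry TopologicalSpace IsLocalRing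
open Literature.AlgebraicGeometry.Resolution Literature.AlgebraicGeometry.Ramification

/-- **Non-p-closed inertia lives in codimension `≥ 2`.** Let `X′` be integral and locally
Noetherian with regular local rings, over a field `k` of characteristic `p` through the affine
`G`-invariant `q : X′ → X₁`, `G` finite acting faithfully. If the inertia group of `z ∈ X′` is not
p-closed then `dim 𝒪_{X′,z} ≥ 2`: it is not `0` (the generic point has trivial inertia) and not `1`
(a regular local ring of dimension `1` is a discrete valuation ring, whose inertia group is
p-closed by Serre IV §2 Cor. 4). [folklore] -/
theorem two_le_ringKrullDim_stalk_of_not_hasNormalSylow (p : ℕ) [Fact p.Prime] {k : Type}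
    [Field k] [CharP k p] {X' X₁ : Scheme.{0}} (f : X₁ ⟶ Spec (.of k)) (q : X' ⟶ X₁)
    [IsAffineHom q] {G : Type} [Group G] [Finite G] (ρ : G →* Aut X')
    (hfaith : Function.Injective ρ) (hρ : ∀ g : G, (ρ g).hom ≫ q = q) [IsIntegral X']
    [IsLocallyNoetherian X'] (hreg : Scheme.IsRegular X') {z : X'}
    (hz : ¬ HasNormalSylow p (inertiaSubgroup ρ z)) :
    (2 : WithBot ℕ∞) ≤ ringKrullDim (X'.presheaf.stalk z) := by
  -- not the generic point
  have hne : genericPoint X' ≠ z := by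
    rintro rfl
    apply hz
    rw [PhaseZeroDimOne.inertiaSubgroup_genericPoint_eq_bot q ρ hρ hfaith]
    exact HasNormalSylow.of_isPGroup IsPGroup.of_bot
  have h0 : 0 < ringKrullDim (X'.presheaf.stalk z) :=
    lt_of_le_of_lt ringKrullDim_nonneg_of_nontrivial
      (ringKrullDim_stalk_lt_of_specializes (genericPoint_specializes z) hne)
  -- not of dimension one: discrete valuation rings have p-closed inertia
  have h1 : ringKrullDim (X'.presheaf.stalk z) ≠ 1 := by
    intro h1
    haveI := hreg z
    haveI := isDiscreteValuationRing_of_isRegularLocalRing_of_ringKrullDim_eq_one _ h1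
    haveI := PhaseZeroDimOne.charP_stalk p (q ≫ f) z
    exact hz (hasNormalSylow_inertiaSubgroup_of_isIntegral ρ p q hρ hfaith z)
  -- a Noetherian local ring has finite dimension
  haveI := hreg z
  obtain ⟨d, hd⟩ := exists_nat_cast_eq_ringKrullDim (R := X'.presheaf.stalk z)
  rw [hd] at h0 h1 ⊢
  have hd0 : d ≠ 0 := by
    rintro rfl
    exact lt_irrefl _ h0
  have hd1 : d ≠ 1 := fun h => h1 (by rw [h]; rfl)
  have h2 : 2 ≤ d := by omega
  exact_mod_cast h2

/-- The contrapositive, as used by a Phase-0 move order: points with local ring of dimension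
`≤ 1` (the generic point, generic points of divisors, points of curves on a surface part) have
p-closed inertia. [folklore] -/
theorem hasNormalSylow_inertia_of_ringKrullDim_stalk_le_one (p : ℕ) [Fact p.Prime] {k : Type}
    [Field k] [CharP k p] {X' X₁ : Scheme.{0}} (f : X₁ ⟶ Spec (.of k)) (q : X' ⟶ X₁)
    [IsAffineHom q] {G : Type} [Group G] [Finite G] (ρ : G →* Aut X')
    (hfaith : Function.Injective ρ) (hρ : ∀ g : G, (ρ g).hom ≫ q = q) [IsIntegral X']
    [IsLocallyNoetherian X'] (hreg : Scheme.IsRegular X') {z : X'}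
    (hz : ringKrullDim (X'.presheaf.stalk z) ≤ 1) :
    HasNormalSylow p (inertiaSubgroup ρ z) := by
  by_contra h
  have h2 := two_le_ringKrullDim_stalk_of_not_hasNormalSylow p f q ρ hfaith hρ hreg h
  have h21 : (2 : WithBot ℕ∞) ≤ 1 := h2.trans hz
  exact absurd h21 (by decide)

end Summit.ResolutionOfSingularities.ResolutionOfSingularities.Theorems.WildQuotientResolution.NpcCodim
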